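import Summits.CriticalPhenomena.PercolationContinuityZ3.Theorems.PercNearOneGluingNoHeavyLowerTailSahiCTCNcGen
import HarnessLib

/-!
# `NoHeavyLowerTail` (crux stmt-CriticalPhenomena-4575), P3 lane: the NORMAL-FORM REDUCTION of the level-3 certificate polynomial `Ñ₃ = Ngen 3`
# to 3-flag configurations (live sets, 3-coloured pairs, 3-coloured common triangles)

Support file (seat `prim-l12-p3`, gen 21; `--supports stmt-CriticalPhenomena-4575`).  Memo `run/shared/lean/prim/prim-l12/FROM-prim-l12-p3-g21-*.md`.
Companion of `…SahiCTCNcGen` (antitonicity of `Ñ_c`) and of `…SahiCTCN2Monotone` (the same reduction at level 2, whose live sets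
`nfLX/nfLZ` and common pair sets `nfA/nfB` are reused verbatim).

By `coeff_Ngen_antitone_left/right`, enlarging `K_X` by sets of size `> 3` or by sets of size `≤ 3` that are not faces of `K_Z` lowers `Ñ₃`
coefficientwise.  Saturating both complexes gives (`coeff_Ngen3_nf_le`) that every pair of down-sets `∋ ∅` dominates coefficientwise its
LEVEL-3 NORMAL FORM `(Fl₃(L_X, E_X, T_X), Fl₃(L_Z, E_Z, T_Z))`: `Fl₃(L, E, T)` (`flagCx3`) is the complex of subsets of `L` all of whose pairs lie
in `E` and all of whose triples lie in `T`; `L_X ∪ L_Z = univ`, `E_X = priv(L_X,L_Z) ∪ A`, `E_Z = priv(L_Z,L_X) ∪ B` with `A, B ⊆ pairs(L_X ∩ L_Z)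
⊆ A ∪ B` (as at level 2), and the triangle sets satisfy `T_X ⊆ tri(L_X,E_X)`, `T_Z ⊆ tri(L_Z,E_Z)`, `tri(L_X,E_X) ∪ tri(L_Z,E_Z) ⊆ T_X ∪ T_Z`
(`nf3_valid`): a triangle of the `X`-graph missing from `T_X` is in `T_Z` and conversely — i.e. common (`Y`-) triangles are 3-coloured
(both / `X` only / `Z` only), one-sided triangles are forced.  `coeff_Ngen3_nonneg_of_configs` packages this: nonnegativity of `Ñ₃` on all such
configurations implies `Ñ₃ ∈ ℕ[r]` for every pair of complexes (on five points: 291 499 configurations, 1 989 up to `S₅ × swap`; the kernel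
check is `…SahiCTCN3Five`).  Nothing is asserted about the crux; no positivity is claimed here.
-/

namespace Summit.CriticalPhenomena.PercolationContinuityZ3.Theorems.SahiCTCForms

open Finset MvPolynomial SahiCTCGenFun

variable {α : Type*} [DecidableEq α] [Fintype α]

/-! ### 3-flag complexes and triangles -/

/-- The 3-flag complex on the live set `L` with pair set `E` and triple set `T`: the subsets of `L` all of whose 2-subsets lie in `E` and all of
whose 3-subsets lie in `T`. [this work] -/
def flagCx3 (L : Finset α) (E T : Finset (Finset α)) : Finset (Finset α) :=
  univ.powerset.filter fun S => S ⊆ L ∧ (∀ e ∈ S.powerset, #e = 2 → e ∈ E) ∧ (∀ t ∈ S.powerset, #t = 3 → t ∈ T)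

/-- The triangles of the graph `(L, E)`: 3-subsets of `L` all of whose pairs lie in `E`. [this work] -/
def tri (L : Finset α) (E : Finset (Finset α)) : Finset (Finset α) :=
  univ.powerset.filter fun t => #t = 3 ∧ t ⊆ L ∧ ∀ e ∈ t.powerset, #e = 2 → e ∈ E

/-- Membership in a 3-flag complex. [this work] -/
theorem mem_flagCx3 {L : Finset α} {E T : Finset (Finset α)} {S : Finset α} :
    S ∈ flagCx3 L E T ↔ S ⊆ L ∧ (∀ e, e ⊆ S → #e = 2 → e ∈ E) ∧ (∀ t, t ⊆ S → #t = 3 → t ∈ T) := by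
  simp only [flagCx3, mem_filter, mem_powerset, subset_univ, true_and]

/-- Membership in `tri`. [this work] -/
theorem mem_tri {L : Finset α} {E : Finset (Finset α)} {t : Finset α} :
    t ∈ tri L E ↔ #t = 3 ∧ t ⊆ L ∧ ∀ e, e ⊆ t → #e = 2 → e ∈ E := by
  simp only [tri, mem_filter, mem_powerset, subset_univ, true_and]

/-- A 3-flag complex is a down-set. [this work] -/
theorem isLowerSet_flagCx3 (L : Finset α) (E T : Finset (Finset α)) : IsLowerSet ((flagCx3 L E T : Finset (Finset α)) : Set (Finset α)) := by
  intro S U hUS hS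
  rw [mem_coe, mem_flagCx3] at hS ⊢
  exact ⟨hUS.trans hS.1, fun e he h2 => hS.2.1 e (he.trans hUS) h2, fun t ht h3 => hS.2.2 t (ht.trans hUS) h3⟩

/-! ### The level-3 normal form -/

section nf
variable (KX KZ : Finset (Finset α))

/-- Normal-form `X`-pairs: private pairs of `L_X` and the common pairs in `K_X` or not in `K_Z` (as at level 2). [this work] -/
def nfEX : Finset (Finset α) := privPairs (nfLX KX KZ) (nfLZ KZ) ∪ nfA KX KZ

/-- Normal-form `Z`-pairs. [this work] -/
def nfEZ : Finset (Finset α) := privPairs (nfLZ KZ) (nfLX KX KZ) ∪ nfB KX KZ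

/-- Normal-form `X`-triangles: triangles of the `X`-graph that are in `K_X` or not in `K_Z`. [this work] -/
def nfTX : Finset (Finset α) := (tri (nfLX KX KZ) (nfEX KX KZ)).filter fun t => t ∈ KX ∨ t ∉ KZ

/-- The level-3 normal-form `X`-complex. [this work] -/
def nfX3 : Finset (Finset α) := flagCx3 (nfLX KX KZ) (nfEX KX KZ) (nfTX KX KZ)

/-- Normal-form `Z`-triangles: triangles of the `Z`-graph that are in `K_Z` or not in the normal-form `X`-complex. [this work] -/
def nfTZ : Finset (Finset α) := (tri (nfLZ KZ) (nfEZ KX KZ)).filter fun t => t ∈ KZ ∨ t ∉ nfX3 KX KZ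

/-- The level-3 normal-form `Z`-complex. [this work] -/
def nfZ3 : Finset (Finset α) := flagCx3 (nfLZ KZ) (nfEZ KX KZ) (nfTZ KX KZ)

variable {KX KZ}

/-- A pair inside a member of the down-set `K_X` is a normal-form `X`-pair. [this work] -/
theorem pair_mem_nfEX (hKX : IsLowerSet (KX : Set (Finset α))) {S e : Finset α} (hS : S ∈ KX) (he : e ⊆ S) (h2 : #e = 2) :
    e ∈ nfEX KX KZ := by
  have hL : S ⊆ nfLX KX KZ := fun v hv => mem_filter.2 ⟨mem_univ _, Or.inl (singleton_mem_of_mem hKX hS hv)⟩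
  have heK : e ∈ KX := hKX he hS
  by_cases heZ : e ⊆ nfLZ KZ
  · exact mem_union_right _ (mem_filter.2 ⟨mem_filter.2 ⟨mem_powerset.2 (subset_univ _), h2, subset_inter (he.trans hL) heZ⟩, Or.inl heK⟩)
  · exact mem_union_left _ (mem_filter.2 ⟨mem_powerset.2 (subset_univ _), h2, he.trans hL, heZ⟩)

/-- A pair inside a member of the down-set `K_Z` is a normal-form `Z`-pair. [this work] -/
theorem pair_mem_nfEZ (hKZ : IsLowerSet (KZ : Set (Finset α))) {S e : Finset α} (hS : S ∈ KZ) (he : e ⊆ S) (h2 : #e = 2) :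
    e ∈ nfEZ KX KZ := by
  have hL : S ⊆ nfLZ KZ := fun v hv => mem_filter.2 ⟨mem_univ _, singleton_mem_of_mem hKZ hS hv⟩
  have heK : e ∈ KZ := hKZ he hS
  by_cases heX : e ⊆ nfLX KX KZ
  · exact mem_union_right _ (mem_filter.2 ⟨mem_filter.2 ⟨mem_powerset.2 (subset_univ _), h2, subset_inter heX (he.trans hL)⟩, heK⟩)
  · exact mem_union_left _ (mem_filter.2 ⟨mem_powerset.2 (subset_univ _), h2, he.trans hL, heX⟩)

/-- `K_X ⊆` its level-3 normal form, for down-sets. [this work] -/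
theorem subset_nfX3 (hKX : IsLowerSet (KX : Set (Finset α))) : KX ⊆ nfX3 KX KZ := by
  intro S hS
  rw [nfX3, mem_flagCx3]
  have hL : S ⊆ nfLX KX KZ := fun v hv => mem_filter.2 ⟨mem_univ _, Or.inl (singleton_mem_of_mem hKX hS hv)⟩
  refine ⟨hL, fun e he h2 => pair_mem_nfEX hKX hS he h2, fun t ht h3 => ?_⟩
  have htK : t ∈ KX := hKX ht hS
  refine mem_filter.2 ⟨mem_tri.2 ⟨h3, ht.trans hL, fun e he h2 => pair_mem_nfEX hKX hS (he.trans ht) h2⟩, Or.inl htK⟩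

/-- The sets added to `K_X` by the level-3 normal form have size `> 3` or are not faces of `K_Z`. [this work] -/
theorem nfX3_diff (h0X : ∅ ∈ KX) (hKZ : IsLowerSet (KZ : Set (Finset α))) :
    ∀ S ∈ nfX3 KX KZ, S ∉ KX → 3 < #S ∨ S ∉ KZ := by
  intro S hS hSX
  by_cases h4 : 3 < #S
  · exact Or.inl h4
  refine Or.inr fun hSZ => ?_
  rw [nfX3, mem_flagCx3] at hS
  rcases Nat.lt_or_ge #S 1 with h0 | h1
  · have hS0 : S = ∅ := card_eq_zero.1 (by omega)
    subst hS0; exact hSX h0X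
  rcases Nat.lt_or_ge #S 2 with h1' | h2
  · obtain ⟨v, rfl⟩ := card_eq_one.1 (show #S = 1 by omega)
    have hv := (mem_filter.1 (hS.1 (mem_singleton_self v))).2
    tauto
  rcases Nat.lt_or_ge #S 3 with h2' | h3
  · have hS2 : #S = 2 := by omega
    rcases mem_union.1 (hS.2.1 S Subset.rfl hS2) with h | h
    · obtain ⟨_, _, _, hnz⟩ := mem_filter.1 h
      exact hnz fun v hv => mem_filter.2 ⟨mem_univ _, singleton_mem_of_mem hKZ hSZ hv⟩
    · have := (mem_filter.1 h).2; tauto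
  · have hS3 : #S = 3 := by omega
    have := (mem_filter.1 (hS.2.2 S Subset.rfl hS3)).2
    tauto

/-- `K_Z ⊆` its level-3 normal form, for down-sets. [this work] -/
theorem subset_nfZ3 (hKZ : IsLowerSet (KZ : Set (Finset α))) : KZ ⊆ nfZ3 KX KZ := by
  intro S hS
  rw [nfZ3, mem_flagCx3]
  have hL : S ⊆ nfLZ KZ := fun v hv => mem_filter.2 ⟨mem_univ _, singleton_mem_of_mem hKZ hS hv⟩
  refine ⟨hL, fun e he h2 => pair_mem_nfEZ hKZ hS he h2, fun t ht h3 => ?_⟩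
  have htK : t ∈ KZ := hKZ ht hS
  exact mem_filter.2 ⟨mem_tri.2 ⟨h3, ht.trans hL, fun e he h2 => pair_mem_nfEZ hKZ hS (he.trans ht) h2⟩, Or.inl htK⟩

/-- The sets added to `K_Z` by the level-3 normal form have size `> 3` or are not faces of the normal-form `X`-complex. [this work] -/
theorem nfZ3_diff (h0Z : ∅ ∈ KZ) : ∀ S ∈ nfZ3 KX KZ, S ∉ KZ → 3 < #S ∨ S ∉ nfX3 KX KZ := by
  intro S hS hSZ
  by_cases h4 : 3 < #S
  · exact Or.inl h4
  refine Or.inr fun hSX => ?_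
  rw [nfZ3, mem_flagCx3] at hS
  rw [nfX3, mem_flagCx3] at hSX
  rcases Nat.lt_or_ge #S 1 with h0 | h1
  · have hS0 : S = ∅ := card_eq_zero.1 (by omega)
    subst hS0; exact hSZ h0Z
  rcases Nat.lt_or_ge #S 2 with h1' | h2
  · obtain ⟨v, rfl⟩ := card_eq_one.1 (show #S = 1 by omega)
    exact hSZ (mem_filter.1 (hS.1 (mem_singleton_self v))).2
  rcases Nat.lt_or_ge #S 3 with h2' | h3
  · have hS2 : #S = 2 := by omega
    rcases mem_union.1 (hS.2.1 S Subset.rfl hS2) with h | h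
    · exact (mem_filter.1 h).2.2.2 hSX.1
    · exact hSZ (mem_filter.1 h).2
  · have hS3 : #S = 3 := by omega
    rcases (mem_filter.1 (hS.2.2 S Subset.rfl hS3)).2 with h | h
    · exact hSZ h
    · exact h (mem_flagCx3.2 hSX)

/-- **LEVEL-3 NORMAL-FORM REDUCTION**: for down-sets `K_X, K_Z ∋ ∅`, `Ñ₃(nfX3, nfZ3) ≤ Ñ₃(K_X, K_Z)` coefficientwise. [this work] -/
theorem coeff_Ngen3_nf_le (hKX : IsLowerSet (KX : Set (Finset α))) (hKZ : IsLowerSet (KZ : Set (Finset α))) (h0X : ∅ ∈ KX) (h0Z : ∅ ∈ KZ)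
    (n : α →₀ ℕ) : (Ngen 3 (nfX3 KX KZ) (nfZ3 KX KZ)).coeff n ≤ (Ngen 3 KX KZ).coeff n := by
  have step1 : (Ngen 3 (nfX3 KX KZ) KZ).coeff n ≤ (Ngen 3 KX KZ).coeff n :=
    coeff_Ngen_antitone_left hKZ _ KX (nfX3 KX KZ) rfl (subset_nfX3 hKX) (nfX3_diff h0X hKZ) n
  have step2 : (Ngen 3 (nfX3 KX KZ) (nfZ3 KX KZ)).coeff n ≤ (Ngen 3 (nfX3 KX KZ) KZ).coeff n :=
    coeff_Ngen_antitone_right (isLowerSet_flagCx3 _ _ _) (subset_nfZ3 hKZ) (nfZ3_diff h0Z) n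
  exact step2.trans step1

/-- The level-3 normal form is a valid configuration: live sets cover, common pairs 3-coloured, triangle sets inside the triangles of their graphs,
and every triangle of either graph lies in `T_X ∪ T_Z`. [this work] -/
theorem nf3_valid (hKZ : IsLowerSet (KZ : Set (Finset α))) :
    nfLX KX KZ ∪ nfLZ KZ = univ ∧ nfA KX KZ ⊆ pairsIn (nfLX KX KZ ∩ nfLZ KZ) ∧ nfB KX KZ ⊆ pairsIn (nfLX KX KZ ∩ nfLZ KZ) ∧
    pairsIn (nfLX KX KZ ∩ nfLZ KZ) ⊆ nfA KX KZ ∪ nfB KX KZ ∧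
    nfTX KX KZ ⊆ tri (nfLX KX KZ) (nfEX KX KZ) ∧ nfTZ KX KZ ⊆ tri (nfLZ KZ) (nfEZ KX KZ) ∧
    tri (nfLX KX KZ) (nfEX KX KZ) ∪ tri (nfLZ KZ) (nfEZ KX KZ) ⊆ nfTX KX KZ ∪ nfTZ KX KZ := by
  obtain ⟨h1, h2, h3, h4⟩ := nf_valid KX KZ
  refine ⟨h1, h2, h3, h4, filter_subset _ _, filter_subset _ _, fun t ht => ?_⟩
  rw [mem_union]
  rcases mem_union.1 ht with htX | htZ
  · by_cases hTX : t ∈ nfTX KX KZ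
    · exact Or.inl hTX
    right
    have hnot : ¬ (t ∈ KX ∨ t ∉ KZ) := fun h => hTX (mem_filter.2 ⟨htX, h⟩)
    have htKZ : t ∈ KZ := by by_contra h; exact hnot (Or.inr h)
    obtain ⟨ht3, _, _⟩ := mem_tri.1 htX
    have hL : t ⊆ nfLZ KZ := fun v hv => mem_filter.2 ⟨mem_univ _, singleton_mem_of_mem hKZ htKZ hv⟩
    exact mem_filter.2 ⟨mem_tri.2 ⟨ht3, hL, fun e he h2 => pair_mem_nfEZ hKZ htKZ he h2⟩, Or.inl htKZ⟩
  · by_cases hTZ : t ∈ nfTZ KX KZ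
    · exact Or.inr hTZ
    left
    have hnot : ¬ (t ∈ KZ ∨ t ∉ nfX3 KX KZ) := fun h => hTZ (mem_filter.2 ⟨htZ, h⟩)
    have htX3 : t ∈ nfX3 KX KZ := by by_contra h; exact hnot (Or.inr h)
    obtain ⟨ht3, _, _⟩ := mem_tri.1 htZ
    rw [nfX3, mem_flagCx3] at htX3
    exact htX3.2.2 t Subset.rfl ht3

end nf

/-- **Reduction to level-3 flag configurations.**  If `Ñ₃ ∈ ℕ[r]` for every configuration
`(Fl₃(L_X, priv ∪ A, T_X), Fl₃(L_Z, priv ∪ B, T_Z))` with `L_X ∪ L_Z = univ`, `A, B ⊆ pairs(L_X ∩ L_Z) ⊆ A ∪ B`, `T_X ⊆ tri(L_X, priv ∪ A)`,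
`T_Z ⊆ tri(L_Z, priv ∪ B)` and `tri(L_X, ·) ∪ tri(L_Z, ·) ⊆ T_X ∪ T_Z`, then `Ñ₃(K_X, K_Z) ∈ ℕ[r]` for every pair of down-sets containing `∅`.
[this work] -/
theorem coeff_Ngen3_nonneg_of_configs
    (h : ∀ (LX LZ : Finset α) (A B TX TZ : Finset (Finset α)), LX ∪ LZ = univ → A ⊆ pairsIn (LX ∩ LZ) → B ⊆ pairsIn (LX ∩ LZ) →
      pairsIn (LX ∩ LZ) ⊆ A ∪ B → TX ⊆ tri LX (privPairs LX LZ ∪ A) → TZ ⊆ tri LZ (privPairs LZ LX ∪ B) →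
      tri LX (privPairs LX LZ ∪ A) ∪ tri LZ (privPairs LZ LX ∪ B) ⊆ TX ∪ TZ →
      ∀ n, 0 ≤ (Ngen 3 (flagCx3 LX (privPairs LX LZ ∪ A) TX) (flagCx3 LZ (privPairs LZ LX ∪ B) TZ)).coeff n)
    {KX KZ : Finset (Finset α)} (hKX : IsLowerSet (KX : Set (Finset α))) (hKZ : IsLowerSet (KZ : Set (Finset α)))
    (h0X : ∅ ∈ KX) (h0Z : ∅ ∈ KZ) (n : α →₀ ℕ) : 0 ≤ (Ngen 3 KX KZ).coeff n := by
  obtain ⟨h1, h2, h3, h4, h5, h6, h7⟩ := nf3_valid (KX := KX) hKZ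
  exact (h _ _ _ _ _ _ h1 h2 h3 h4 h5 h6 h7 n).trans (coeff_Ngen3_nf_le hKX hKZ h0X h0Z n)

end Summit.CriticalPhenomena.PercolationContinuityZ3.Theorems.SahiCTCForms
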